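import Summits.ResolutionOfSingularities.ResolutionOfSingularities.Theorems.WeightedInvariantTerminatingCentreDatumDim
import Summits.ResolutionOfSingularities.ResolutionOfSingularities.Theorems.WeightedInvariantHypersurfaceAdmissibleSequencesDim
import HarnessLib

/-!
# ∃-rung `e` ⇒ datum-rung `e` — the two e-ladders of the door `HypersurfaceCentreConstruction` agree rung by rung

Route `ResolutionOfSingularities/WeightedInvariant`, crux `Theses.WeightedInvariant.HypersurfaceCentreConstruction`
(stmt-ResolutionOfSingularities-19897), door line `local-engine`; CRUX-PLAN r1 §v6.4 (4) of `res-L1-w43-plan-1`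
(`res-L1-w43-stub-10`: e-ladder of the door).

`Theorems/…HypersurfaceAdmissibleSequencesDim.lean` types the ∃-rungs `AdmissiblyResolvableDim p e` (every
singular hypersurface pair of START dimension `e` over a perfect field of characteristic `p` admits a finite
admissible centre sequence) and `Theorems/…TerminatingCentreDatumDim.lean` the datum-rungs
`Nonempty (HypersurfaceTerminatingCentreDatumDim p e)` (the door datum with its axioms demanded on the pairs
reached in transversal dimension `e` along its own towers).  This file proves **∃-rung `e` ⇒ datum-rung `e`**:

* `HypersurfacePair.resolvable_of_reachDim_seqCentre` — under ∃-rung `e`, every pair reached in transversal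
  dimension `e` along the towers of the rule `seqCentre` (first centre of a length-minimising admissible
  sequence, `Theorems/…HypersurfaceAdmissibleSequences.lean`) is admissibly resolvable: the start is (∃-rung, or
  regular), and the successor of a resolvable singular pair along the (unique) Rees filtration with the pieces
  of `seqCentre` is the second pair of a minimiser;
* `HypersurfaceTerminatingCentreDatumDim.ofAdmissiblyResolvableDim` — `Γ := Bool`, `inv := singRating`,
  `centre := seqCentre`, `Λ := ℕ`, `rank := minLength` is a datum in transversal dimension `e` (the sliced
  twin of `HypersurfaceTerminatingCentreDatum.ofFiniteSequences`);
* `nonempty_terminatingDim_of_admissiblyResolvableDim`, `nonempty_choiceDim_of_admissiblyResolvableDim` —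
  ∃-rung `e` ⇒ datum-rung `e` ⇒ choice-rung `e` (`HypersurfaceCentreChoiceDim p e`).

So a closed-modulo-facts proof of an ∃-rung (the form in which Abramovich–Quek–Schober's Thm. 1.1 is printed
for `e = 1`: «iterating, one obtains in finitely many steps» a regular strict transform) lands all three rungs
at once.  Nothing here is a claim about Hironaka's problem; no rung `e ≥ 1` is asserted.
-/

noncomputable section

open CategoryTheory AlgebraicGeometry TopologicalSpace
open Literature.AlgebraicGeometry.Resolution

set_option linter.dupNamespace false -- mandated namespace of this single-conjunct summit

namespace Summit.ResolutionOfSingularities.ResolutionOfSingularities.Theorems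

/-! ## Reached pairs of the minimiser rule are resolvable -/

namespace HypersurfacePair

variable {p e : ℕ} {k : Type} [Field k]

/-- The hypotheses of a hypersurface pair, as the `Prop` `IsHypersurfacePair`. [folklore] -/
theorem isHypersurfacePair (P : HypersurfacePair k) : IsHypersurfacePair P.f P.X :=
  ⟨P.smooth, P.isSeparated, P.quasiCompact, P.isLocallyPrincipal, P.isIntegral⟩

/-- **The successor of a resolvable singular pair along the pieces of `seqCentre` is resolvable**: the Rees
filtration with the pieces of the first centre of a minimiser is unique (`reesFiltration_eq_of_ideal_eq`), so a
`Step`-successor for the rule `seqCentre` is the minimiser's second pair, admissibly resolvable in one step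
less. [folklore] -/
theorem resolvable_of_step_seqCentre {P P' : HypersurfacePair k} (hres : P.Resolvable)
    (hstep : Step (fun ⦃Y : Scheme.{0}⦄ (f : Y ⟶ Spec (.of k)) X => seqCentre f X) P' P) :
    P'.Resolvable := by
  obtain ⟨Y, f, X, hX, hXi⟩ := P
  obtain ⟨hsing, R'', hR'', hs'', hsep'', hqc'', hlp'', hint'', rfl⟩ := hstep
  have hP : IsHypersurfacePair f X := ⟨‹_›, ‹_›, ‹_›, hX, hXi⟩
  obtain ⟨n, ⟨_, R', hR', hs, hsep, hqc, hlp, hint, hres'⟩, _⟩ := seqCentre_spec f X hP hres hsing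
  obtain rfl : R'' = R' := reesFiltration_eq_of_ideal_eq (hR''.trans hR'.symm)
  exact ⟨n, hres'⟩

/-- **Under ∃-rung `e`, every pair reached in transversal dimension `e` along the towers of `seqCentre` is
admissibly resolvable** (induction along the reachability chain: the start has an `e`-dimensional
hypersurface, resolvable by the ∃-rung if singular and in `0` steps if regular; steps by
`resolvable_of_step_seqCentre`). [folklore] -/
theorem resolvable_of_reachDim_seqCentre [CharP k p] [PerfectField k] (h : AdmissiblyResolvableDim p e)
    (P : HypersurfacePair k)
    (hP : ReachDim (fun ⦃Y : Scheme.{0}⦄ (f : Y ⟶ Spec (.of k)) X => seqCentre f X) e P) :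
    P.Resolvable := by
  obtain ⟨P₀, h0, hch⟩ := hP
  induction hch with
  | refl => exact (admissiblyResolvableDim_iff_forall_resolvable p e).mp h P₀ h0
  | tail _ hstep ih => exact resolvable_of_step_seqCentre ih hstep

end HypersurfacePair

/-! ## The datum in transversal dimension `e` of the minimiser rule -/

namespace HypersurfaceTerminatingCentreDatumDim

variable {p e : ℕ}

/-- **∃-rung `e` gives a hypersurface terminating centre datum in transversal dimension `e`**: rate by
`CentreRankDatum.singRating` (`Γ := Bool`), centre := `seqCentre` (first centre of a length-minimising
admissible sequence), `Λ := ℕ`, `rank := minLength`.  On a pair reached in transversal dimension `e` along the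
towers of `seqCentre` whose hypersurface is singular, the pair is resolvable
(`HypersurfacePair.resolvable_of_reachDim_seqCentre`), so `seqCentre_spec` releases `(iii-a)`, `(iii-b′)`,
`(hom)` (admissibility of the head) and `(term)` (the successor along the unique Rees filtration with the
pieces of the head is the minimiser's second pair, of smaller minimal length) — verbatim the field proofs of
`HypersurfaceTerminatingCentreDatum.ofFiniteSequences`, with resolvability supplied by reachability instead of
by hypothesis. [folklore] -/
def ofAdmissiblyResolvableDim (h : AdmissiblyResolvableDim p e) :
    HypersurfaceTerminatingCentreDatumDim p e where
  Γ := Bool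
  inv := fun _ _ _ _ X y => CentreRankDatum.singRating X y
  centre := fun _ _ _ f X => seqCentre f X
  Λ := ℕ
  rank := fun _ _ _ f X => minLength f X
  isBot_inv_iff := fun _ _ _ _ _ _ _ _ _ X _ _ y => CentreRankDatum.isBot_singRating_iff X y
  isRegularWeightedCentre_centre := fun k _ _ _ P hP hguard => by
    have hsing := (CentreRankDatum.exists_not_isBot_singRating_iff P.X).mp hguard
    have hres := HypersurfacePair.resolvable_of_reachDim_seqCentre h P hP
    obtain ⟨Y, f, X, hX, hXi⟩ := P
    obtain ⟨n, hhead, _⟩ := seqCentre_spec f X ⟨‹_›, ‹_›, ‹_›, hX, hXi⟩ hres hsing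
    exact hhead.1.1
  support_centre_subset := fun k _ _ _ P hP hguard y hy => by
    have hsing := (CentreRankDatum.exists_not_isBot_singRating_iff P.X).mp hguard
    have hres := HypersurfacePair.resolvable_of_reachDim_seqCentre h P hP
    obtain ⟨Y, f, X, hX, hXi⟩ := P
    obtain ⟨n, hhead, _⟩ := seqCentre_spec f X ⟨‹_›, ‹_›, ‹_›, hX, hXi⟩ hres hsing
    exact (mem_singImage_iff_not_isBot_singRating X y).mp (hhead.1.2.1 hy)
  centre_isHomogeneous := fun k _ _ _ P hP hguard j W 𝒜 _ h0 hXhom n => by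
    have hsing := (CentreRankDatum.exists_not_isBot_singRating_iff P.X).mp hguard
    have hres := HypersurfacePair.resolvable_of_reachDim_seqCentre h P hP
    obtain ⟨Y, f, X, hX, hXi⟩ := P
    obtain ⟨m, hhead, _⟩ := seqCentre_spec f X ⟨‹_›, ‹_›, ‹_›, hX, hXi⟩ hres hsing
    exact hhead.1.2.2 j W 𝒜 h0 hXhom n
  rank_lt := fun k _ _ _ P hP hguard R'' hR'' => by
    have hsing := (CentreRankDatum.exists_not_isBot_singRating_iff P.X).mp hguard
    have hres := HypersurfacePair.resolvable_of_reachDim_seqCentre h P hP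
    obtain ⟨Y, f, X, hX, hXi⟩ := P
    obtain ⟨n, ⟨_, R', hR', hs, hsep, hqc, hlp, hint, hres'⟩, hn⟩ :=
      seqCentre_spec f X ⟨‹_›, ‹_›, ‹_›, hX, hXi⟩ hres hsing
    -- the Rees filtration with the pieces of the first centre is unique
    obtain rfl : R'' = R' := reesFiltration_eq_of_ideal_eq (hR''.trans hR'.symm)
    -- the successor along it is the minimiser's second pair, resolvable in `n` steps
    have hP' : IsHypersurfacePair (R''.πPlus ≫ f) (R''.strictTransformPlus X) := ⟨hs, hsep, hqc, hlp, hint⟩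
    change minLength (R''.πPlus ≫ f) (R''.strictTransformPlus X) < minLength f X
    calc minLength (R''.πPlus ≫ f) (R''.strictTransformPlus X) ≤ n := minLength_le _ _ hP' hres'
      _ < n + 1 := Nat.lt_succ_self n
      _ = minLength f X := hn

/-- The datum of the minimiser rule is centred by `seqCentre`. [folklore] -/
@[simp] theorem ofAdmissiblyResolvableDim_centre (h : AdmissiblyResolvableDim p e) {k : Type} [Field k]
    {Y : Scheme.{0}} (f : Y ⟶ Spec (.of k)) (X : Y.IdealSheafData) :
    (ofAdmissiblyResolvableDim h).centre f X = seqCentre f X := rfl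

/-- The datum of the minimiser rule is ranked by `minLength` (`Λ := ℕ`). [folklore] -/
@[simp] theorem ofAdmissiblyResolvableDim_rank (h : AdmissiblyResolvableDim p e) {k : Type} [Field k]
    {Y : Scheme.{0}} (f : Y ⟶ Spec (.of k)) (X : Y.IdealSheafData) :
    (ofAdmissiblyResolvableDim h).rank f X = minLength f X := rfl

end HypersurfaceTerminatingCentreDatumDim

/-! ## ∃-rung ⇒ datum-rung ⇒ choice-rung -/

/-- **∃-rung `e` ⇒ datum-rung `e` of the door**: admissible resolvability from start dimension `e` in
characteristic `p` gives a hypersurface terminating centre datum in transversal dimension `e`. [folklore] -/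
theorem nonempty_terminatingDim_of_admissiblyResolvableDim {p e : ℕ} (h : AdmissiblyResolvableDim p e) :
    Nonempty (HypersurfaceTerminatingCentreDatumDim p e) :=
  ⟨HypersurfaceTerminatingCentreDatumDim.ofAdmissiblyResolvableDim h⟩

/-- **∃-rung `e` ⇒ choice-rung `e`** (through the datum-rung and H1c sliced, `toChoiceDim`): admissible
resolvability from start dimension `e` gives a hypersurface centre choice in transversal dimension `e`, the
rung consumed by RESHAPE 9's tower (`weightedThesis_of_hypersurfaceChoiceDim_of_forall_berghRydh_charP`).
[folklore] -/
theorem nonempty_choiceDim_of_admissiblyResolvableDim {p e : ℕ} (h : AdmissiblyResolvableDim p e) :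
    Nonempty (HypersurfaceCentreChoiceDim p e) :=
  ⟨(HypersurfaceTerminatingCentreDatumDim.ofAdmissiblyResolvableDim h).toChoiceDim⟩

end Summit.ResolutionOfSingularities.ResolutionOfSingularities.Theorems

end
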